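import Summits.Ventures.DiscreteObjects.Hadamard.NormalizingPermTools
import Summits.Ventures.DiscreteObjects.Hadamard.Order333Dihedral668
import Literature.Combinatorics.Designs.LegendrePairs.MultiplierObstruction

/-!
# H(668): the NORMALISER of an element of order 333 ⇔ the MULTIPLIER GROUP of the Legendre pair (kernel) — automorphisms
# normalising the order-333 element preserve all four cores or none, and a core-preserving one is a multiplier of an LP(333)

Framing: lottery ticket; floor = certified bounds/negative ranges.

Cell pub-namedobj (venture DiscreteObjects), target (H), hadamard gen 20 (HANDOFF-H-g19 item 3).  Let `σ = (π, κ, d, e)` be a signed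
automorphism of a Hadamard matrix of order `668` of pair order `333` (two fixed points + two regular orbits = 'cores' on each side,
gen 19 `hadamard668_order333_orbitType`) and `τ = (π', κ', d', e')` a signed automorphism NORMALISING its permutation pair with
multiplier `μ`: `π'π = π^μ π'`, `κ'κ = κ^μ κ'` (then `gcd(μ, 333) = 1` is forced: `coprime_of_normalizing`).  Results:
* **`normalizing_rows_preserved_main`** / **`hadamard668_order333_normalizing_all_or_none`**: `τ` maps SOME free row into its own
  `σ`-orbit iff it maps EVERY free row and EVERY free column into its own orbit; otherwise it moves every free row and every free
  column out of its orbit (exchanges the cores on both sides).  [Re-sign `σ` to a permutation pair (`ResignOddOrder`); the signs of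
  `τ` are then constant along `σ`-orbits; if `π' x₀ = π^c x₀`, read the Legendre pair `(a, b)` of `x₀` (`CyclicCorePAF`): the relation
  `H'(π' x₀, κ' j) = ± H'(x₀, j)` says `seq_{κ' y}(μ t + γ) = ± seq_y(t)`; if `κ'` exchanged the two column orbits this gives
  `PAF_b(μ s) = PAF_a(s)`, impossible by the 3-compression parity `legendrePair333_paf_twist_ne` (gen 20); the column → row
  direction is the same statement for `Hᵀ`.]
* **`hadamard668_order333_normalizer_multiplier`** (the dictionary): if `τ` preserves the cores, then `a(μ t + γ) = a(t)`,
  `b(μ t + γ') = b(t)` (the sign is `+` because `Σ a = ±1 ≠ 0`), i.e. the pair is translation-twisted `μ`-invariant, hence by the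
  centroid shift [Kotsireas–Koutschan–Bulutoglu–Arquette–Turner–Ryan 2023, Cor. 1 = `exists_twisted_iff`] **a Legendre pair of length
  333 invariant under the multiplier `μ` in the narrow sense of [Ramos–Hulak–de Queiroz 2026, Def. 2] exists.**  So RHdQ's Table A1 of
  multiplier subgroups `H ≤ (ℤ/333)ˣ` is literally the table of candidate groups `N ∩ (core-preserving) / ⟨σ⟩` for the normaliser
  `N` of `⟨σ⟩` in the automorphism group of an LP-type H(668) (the centraliser is `±⟨σ⟩`, gen 19 p328716; the converse realisation
  — an `H`-invariant pair gives the multiplier automorphisms of the two-circulant matrix — is `Order333NormalizerIff668`).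
* Corollaries **`hadamard668_order333_normalizer_mod3`**: `μ ≡ 1 (mod 3)` [RHdQ Prop. 1, `rhdq_prop1'`]; and
  **`hadamard668_order333_normalizer_not_112_family`**: `μ mod 333 ∉ {31, 43, 112, 142, 184, 223, 265, 295}` — the units `≡ 1 (mod 3)`
  a power of which is `112` or `223` [`no_legendrePair_mul`, the pub-lottery cell's `n/3 + 1` obstruction; rows 2, 7, 11, 15, 24].
Structure of a hypothetical object; no order excluded; H(668) untouched.  Ours (LP-side inputs: RHdQ 2026 Prop. 1 = replication; KKBATR
2023 Cor. 1 = replication; the 112-obstruction and the parity lemma are the cells' kernel theorems); no `sorry`, no definitions.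
-/

namespace Summit.Ventures.DiscreteObjects.Hadamard

open Finset BigOperators Matrix

open Literature.Combinatorics.Designs.GoethalsSeidel (IsHadamardMatrix)
open Literature.Combinatorics.Designs.LegendrePairs (PAF IsPM LegendrePair TwistedInvariant HInvariant exists_twisted_iff
  rowsum_sq pm_of_sq no_legendrePair_mul)
open Literature.Combinatorics.Designs.LegendrePairs.NineComp333 (rhdq_prop1')

variable {ι : Type*} [Fintype ι] [DecidableEq ι]

/-! ### the main lemma -/

section main
variable {H : Matrix ι ι ℤ}

/-- **Main lemma.**  `σ` of pair order `333`, `τ` normalising it with multiplier `μ`; if `τ` maps the free row `x₀` into its own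
`σ`-orbit then (i) `τ` maps EVERY free column into its own `σ`-orbit, and (ii) there are a unit `u = μ (mod 333)` and a Legendre pair
of length `333` both of whose sequences are translation-twisted `u`-invariant. -/
theorem normalizing_rows_preserved_main (hH : IsHadamardMatrix H) (hι : Fintype.card ι = 668)
    {π κ π' κ' : Equiv.Perm ι} {d e d' e' : ι → ℤ} (haut : IsSignedAut H π κ d e)
    (hπ : π ^ 333 = 1) (hκ : κ ^ 333 = 1) (h111 : π ^ 111 ≠ 1 ∨ κ ^ 111 ≠ 1) (h9 : π ^ 9 ≠ 1 ∨ κ ^ 9 ≠ 1)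
    (haut' : IsSignedAut H π' κ' d' e') {μ : ℕ} (hnπ : π' * π = π ^ μ * π') (hnκ : κ' * κ = κ ^ μ * κ')
    {x₀ : ι} (hx₀ : π x₀ ≠ x₀) (hmem : π' x₀ ∈ orbFin π 333 x₀) :
    (∀ y, κ y ≠ y → κ' y ∈ orbFin κ 333 y) ∧
    ∃ (u : (ZMod 333)ˣ) (a b : ZMod 333 → ℤ), (u : ZMod 333) = (μ : ZMod 333) ∧ LegendrePair a b ∧
      TwistedInvariant a u ∧ TwistedInvariant b u := by
  have hcop := coprime_of_normalizing hπ hκ h111 h9 hnπ hnκ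
  set u : (ZMod 333)ˣ := ZMod.unitOfCoprime μ hcop with hudef
  have hu : (u : ZMod 333) = (μ : ZMod 333) := ZMod.coe_unitOfCoprime μ hcop
  obtain ⟨⟨hR2, hRfree⟩, hC2, hCfree⟩ := hadamard668_order333_orbitType hH hι π κ d e haut hπ hκ h111 h9
  -- re-sign: σ becomes a permutation pair of H'
  obtain ⟨s, t, hs, ht, hH', hinv⟩ := exists_resign_of_odd hH haut (by decide : Odd 333) hπ hκ
  set H' : Matrix ι ι ℤ := Matrix.of fun i j => s i * t j * H i j with hH'def
  have hinv' : ∀ i j, H' (π i) (κ j) = H' i j := fun i j => by simp only [hH'def, Matrix.of_apply]; exact hinv i j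
  have hinvm : ∀ m i j, H' ((π ^ m) i) ((κ ^ m) j) = H' i j := perm_aut_pow hinv'
  -- τ on H'
  set d₁ : ι → ℤ := fun i => s (π' i) * s i * d' i with hd₁
  set e₁ : ι → ℤ := fun j => t (κ' j) * t j * e' j with he₁
  have hτ : ∀ i j, H' (π' i) (κ' j) = d₁ i * e₁ j * H' i j := by
    intro i j
    simp only [hH'def, Matrix.of_apply, hd₁, he₁]
    rw [haut'.2.2 i j]
    have h1 := pm_mul_self (hs i); have h2 := pm_mul_self (ht j)
    calc s (π' i) * t (κ' j) * (d' i * e' j * H i j)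
        = s (π' i) * t (κ' j) * (d' i * e' j * H i j) * ((s i * s i) * (t j * t j)) := by rw [h1, h2]; ring
      _ = s (π' i) * s i * d' i * (t (κ' j) * t j * e' j) * (s i * t j * H i j) := by ring
  have hd₁pm : ∀ i, d₁ i = 1 ∨ d₁ i = -1 := fun i => by
    rcases hs (π' i) with h1 | h1 <;> rcases hs i with h2 | h2 <;> rcases haut'.1 i with h3 | h3 <;> simp [hd₁, h1, h2, h3]
  have he₁pm : ∀ j, e₁ j = 1 ∨ e₁ j = -1 := fun j => by
    rcases ht (κ' j) with h1 | h1 <;> rcases ht j with h2 | h2 <;> rcases haut'.2.1 j with h3 | h3 <;> simp [he₁, h1, h2, h3]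
  have hH'ne : ∀ i j, H' i j ≠ 0 := fun i j => pm_ne_zero (hH'.1 i j)
  -- sign constancy along σ-orbits
  have key : ∀ x y, d₁ (π x) * e₁ (κ y) * H' x y = d₁ x * e₁ y * H' x y := by
    intro x y
    have h1 : H' (π' (π x)) (κ' (κ y)) = d₁ (π x) * e₁ (κ y) * H' x y := by rw [hτ, hinv']
    rw [norm_apply hnπ x, norm_apply hnκ y, hinvm, hτ] at h1
    exact h1.symm
  obtain ⟨w, hw⟩ : ∃ w, κ w = w := by
    obtain ⟨w, hw⟩ := Finset.card_pos.mp (by rw [hC2]; norm_num : 0 < (univ.filter fun j => κ j = j).card)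
    exact ⟨w, (Finset.mem_filter.mp hw).2⟩
  obtain ⟨v, hv⟩ : ∃ v, π v = v := by
    obtain ⟨v, hv⟩ := Finset.card_pos.mp (by rw [hR2]; norm_num : 0 < (univ.filter fun i => π i = i).card)
    exact ⟨v, (Finset.mem_filter.mp hv).2⟩
  have heκ : ∀ y, e₁ (κ y) = e₁ y := by
    intro y
    have h := key v y
    rw [hv] at h
    have hne : d₁ v * H' v y ≠ 0 := mul_ne_zero (pm_ne_zero (hd₁pm v)) (hH'ne v y)
    have : (e₁ (κ y) - e₁ y) * (d₁ v * H' v y) = 0 := by linarith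
    rcases mul_eq_zero.mp this with h0 | h0
    · linarith
    · exact (hne h0).elim
  have heκpow : ∀ k y, e₁ ((κ ^ k) y) = e₁ y := by
    intro k; induction k with
    | zero => intro y; simp
    | succ k ih => intro y; rw [pow_succ', Equiv.Perm.mul_apply, heκ, ih]
  -- π' x₀ = π^c x₀
  obtain ⟨c, -, hc⟩ := Finset.mem_image.mp hmem
  -- the column transversal {y₃, y₄} and the Legendre pair of x₀
  have hstab : ∀ y ∈ univ.filter (fun y => κ y ≠ y), κ y ∈ univ.filter (fun y => κ y ≠ y) := by
    intro y hy; rw [Finset.mem_filter] at hy ⊢; exact ⟨Finset.mem_univ _, fun h => hy.2 (κ.injective h)⟩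
  obtain ⟨T, hTsub, hTc, hT⟩ := exists_free_transversal κ (by norm_num : 0 < 333) _ (univ.filter fun y => κ y ≠ y) le_rfl
    hstab (fun y _ => by rw [hκ, Equiv.Perm.one_apply]) (fun y hy => hCfree y (Finset.mem_filter.mp hy).2)
  have hsplit := Finset.card_filter_add_card_filter_not (s := (univ : Finset ι)) (fun y => κ y = y)
  rw [hC2, Finset.card_univ, hι] at hsplit
  have hm666 : (univ.filter fun y => ¬ κ y = y).card = 666 := by omega
  have hm666' : (univ.filter fun y => κ y ≠ y).card = 666 := hm666
  rw [hm666'] at hTc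
  obtain ⟨y₃, y₄, hne34, hT34⟩ := Finset.card_eq_two.mp (by omega : T.card = 2)
  have hy₃T : y₃ ∈ T := by rw [hT34]; simp
  have hy₄T : y₄ ∈ T := by rw [hT34]; simp
  have hx₀free : ∀ k, 0 < k → k < 333 → (π ^ k) x₀ ≠ x₀ := hRfree x₀ hx₀
  -- the Legendre pair (a, b)
  set a : ZMod 333 → ℤ := fun r => H' x₀ ((κ ^ r.val) y₃) with ha
  set b : ZMod 333 → ℤ := fun r => H' x₀ ((κ ^ r.val) y₄) with hb
  have hpafa : ∀ z : ZMod 333, PAF a z = ∑ k ∈ Finset.range 333, H' x₀ ((κ ^ k) y₃) * H' x₀ ((κ ^ (k + z.val)) y₃) := by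
    intro z
    unfold PAF
    have hterm : ∀ r : ZMod 333, a r * a (r + z) = H' x₀ ((κ ^ r.val) y₃) * H' x₀ ((κ ^ (r.val + z.val)) y₃) := by
      intro r; simp only [ha]; rw [ZMod.val_add, pow_mod_of_pow_eq_one κ hκ]
    simp only [hterm]
    exact sum_zmod_val_eq_sum_range (fun k => H' x₀ ((κ ^ k) y₃) * H' x₀ ((κ ^ (k + z.val)) y₃))
  have hpafb : ∀ z : ZMod 333, PAF b z = ∑ k ∈ Finset.range 333, H' x₀ ((κ ^ k) y₄) * H' x₀ ((κ ^ (k + z.val)) y₄) := by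
    intro z
    unfold PAF
    have hterm : ∀ r : ZMod 333, b r * b (r + z) = H' x₀ ((κ ^ r.val) y₄) * H' x₀ ((κ ^ (r.val + z.val)) y₄) := by
      intro r; simp only [hb]; rw [ZMod.val_add, pow_mod_of_pow_eq_one κ hκ]
    simp only [hterm]
    exact sum_zmod_val_eq_sum_range (fun k => H' x₀ ((κ ^ k) y₄) * H' x₀ ((κ ^ (k + z.val)) y₄))
  have hL : LegendrePair a b := by
    refine ⟨fun r => hH'.1 _ _, fun r => hH'.1 _ _, fun z hz => ?_⟩
    obtain ⟨hz0, hzn⟩ := zmod_val_pos_of_ne_zero hz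
    have hid := cyclicCore_paf_identity hH' hinv' hπ T hT hx₀free hz0 hzn
    rw [hT34, Finset.sum_pair hne34, hC2] at hid
    rw [hpafa, hpafb]
    exact_mod_cast hid
  have hsuma : ∑ r, a r ≠ 0 := by
    rcases pm_of_sq _ _ (rowsum_sq a b hL) with h | h <;> rw [h] <;> norm_num
  have hsumb : ∑ r, b r ≠ 0 := by
    rcases pm_of_sq _ _ (by rw [add_comm]; exact rowsum_sq a b hL) with h | h <;> rw [h] <;> norm_num
  -- the fundamental relation along the cycle of y ∈ {y₃, y₄}: τ acts affinely on the sequences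
  have hrel : ∀ (y r : ι) (j : ℕ), κ' y = (κ ^ j) r → ∀ k : ℕ,
      H' x₀ ((κ ^ (μ * k + j + 332 * c)) r) = d₁ x₀ * e₁ y * H' x₀ ((κ ^ k) y) := by
    intro y r j hyr k
    have h1 := hτ x₀ ((κ ^ k) y)
    rw [heκpow, ← hc, norm_apply_pow hnκ k y, hyr, ← Equiv.Perm.mul_apply, ← pow_add] at h1
    have h2 : H' ((π ^ c) x₀) ((κ ^ (μ * k + j)) r) = H' x₀ ((κ ^ (μ * k + j + 332 * c)) r) := by
      have e : κ ^ (μ * k + j) = κ ^ c * κ ^ (μ * k + j + 332 * c) := by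
        rw [← pow_add]
        apply pow_eq_pow_of_natCast_eq hκ
        have h333 : (333 : ZMod 333) = 0 := by decide
        push_cast
        linear_combination (-(c : ZMod 333)) * h333
      rw [e, Equiv.Perm.mul_apply, hinvm]
    rw [← h2, h1]
  -- the same in `ZMod 333` language
  have haff : ∀ (y r : ι) (j : ℕ), κ' y = (κ ^ j) r → ∀ tt : ZMod 333,
      H' x₀ ((κ ^ (((u : ZMod 333) * tt + ((j : ZMod 333) + 332 * (c : ZMod 333))).val)) r) =
        d₁ x₀ * e₁ y * H' x₀ ((κ ^ tt.val) y) := by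
    intro y r j hyr tt
    rw [← hrel y r j hyr tt.val]
    congr 2
    apply pow_eq_pow_of_natCast_eq hκ
    rw [ZMod.natCast_zmod_val, hu]
    push_cast
    rw [ZMod.natCast_zmod_val]
    ring
  have hηpm : ∀ y, d₁ x₀ * e₁ y = 1 ∨ d₁ x₀ * e₁ y = -1 := fun y => by
    rcases hd₁pm x₀ with h1 | h1 <;> rcases he₁pm y with h2 | h2 <;> simp [h1, h2]
  -- where does κ' send y₃ and y₄?
  have hmv : ∀ y, κ y ≠ y → κ (κ' y) ≠ κ' y := fun y hy => by
    simpa only [pow_one] using norm_pow_moved hnκ 1 (by simpa only [pow_one] using hy)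
  have hmv3 : κ (κ' y₃) ≠ κ' y₃ := hmv y₃ (Finset.mem_filter.mp (hTsub hy₃T)).2
  have hmv4 : κ (κ' y₄) ≠ κ' y₄ := hmv y₄ (Finset.mem_filter.mp (hTsub hy₄T)).2
  obtain ⟨r₃, hr₃T, j₃, hj₃, hrj₃⟩ := exists_rep_of_moved T hT hmv3
  obtain ⟨r₄, hr₄T, j₄, hj₄, hrj₄⟩ := exists_rep_of_moved T hT hmv4
  have mem2 : ∀ r ∈ T, r = y₃ ∨ r = y₄ := fun r hr => by simpa [hT34] using hr
  -- the two images lie in different orbits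
  have hdiff : r₃ ≠ r₄ := by
    intro heq
    subst heq
    -- κ' (κ^m y₃) = κ' y₄ for a suitable m, so y₄ lies on the cycle of y₃
    obtain ⟨m, hm⟩ : ∃ m : ℕ, ((μ * m + j₃ : ℕ) : ZMod 333) = ((j₄ : ℕ) : ZMod 333) := by
      refine ⟨((↑u⁻¹ : ZMod 333) * ((j₄ : ZMod 333) - (j₃ : ZMod 333))).val, ?_⟩
      push_cast
      rw [ZMod.natCast_zmod_val, ← hu, ← mul_assoc, Units.mul_inv, one_mul]
      ring
    have h1 : κ' ((κ ^ m) y₃) = κ' y₄ := by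
      rw [norm_apply_pow hnκ m y₃, ← hrj₃, ← Equiv.Perm.mul_apply, ← pow_add, pow_eq_pow_of_natCast_eq hκ hm, hrj₄]
    have h2 : (κ ^ (m % 333)) y₃ = (κ ^ 0) y₄ := by
      rw [pow_mod_of_pow_eq_one κ hκ, pow_zero, Equiv.Perm.one_apply]; exact κ'.injective h1
    obtain ⟨h3, -⟩ := orbitMap_unique κ T (univ.filter fun y => κ y ≠ y) hT hy₃T hy₄T (Nat.mod_lt _ (by norm_num))
      (by norm_num) (by rw [h2, pow_zero, Equiv.Perm.one_apply]; exact hTsub hy₄T) h2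
    exact hne34 h3
  rcases mem2 r₃ hr₃T with h3 | h3
  · -- Case A: κ' preserves both column orbits; both sequences are affinely self-similar
    rw [h3] at hrj₃ hdiff
    have h4 : r₄ = y₄ := by
      rcases mem2 r₄ hr₄T with h | h
      · exact (hdiff h.symm).elim
      · exact h
    rw [h4] at hrj₄
    have hA : ∀ tt : ZMod 333, a ((u : ZMod 333) * tt + ((j₃ : ZMod 333) + 332 * (c : ZMod 333))) = (d₁ x₀ * e₁ y₃) * a tt :=
      fun tt => haff y₃ y₃ j₃ hrj₃.symm tt
    have hB : ∀ tt : ZMod 333, b ((u : ZMod 333) * tt + ((j₄ : ZMod 333) + 332 * (c : ZMod 333))) = (d₁ x₀ * e₁ y₄) * b tt :=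
      fun tt => haff y₄ y₄ j₄ hrj₄.symm tt
    have hηa := eta_eq_one_of_affine a u _ (hηpm y₃) hA hsuma
    have hηb := eta_eq_one_of_affine b u _ (hηpm y₄) hB hsumb
    rw [hηa] at hA; rw [hηb] at hB
    simp only [one_mul] at hA hB
    refine ⟨fun y hy => ?_, u, a, b, hu, hL, twisted_of_affine a u _ hA, twisted_of_affine b u _ hB⟩
    -- every free column stays in its orbit
    obtain ⟨r, hrT, k, hk, hry⟩ := exists_rep_of_moved T hT hy
    have hback : (κ ^ (333 - k)) y = r := by
      rw [← hry, ← Equiv.Perm.mul_apply, ← pow_add, show 333 - k + k = 333 by omega, hκ, Equiv.Perm.one_apply]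
    have hy333 : (κ ^ 333) y = y := by rw [hκ, Equiv.Perm.one_apply]
    obtain ⟨j, hj⟩ : ∃ j : ℕ, κ' r = (κ ^ j) r := by
      rcases mem2 r hrT with rfl | rfl
      · exact ⟨j₃, hrj₃.symm⟩
      · exact ⟨j₄, hrj₄.symm⟩
    have e1 : κ' y = (κ ^ (μ * k + j + (333 - k))) y := by
      conv_lhs => rw [← hry]
      rw [norm_apply_pow hnκ k r, hj, pow_add κ (μ * k + j) (333 - k), Equiv.Perm.mul_apply, hback, pow_add,
        Equiv.Perm.mul_apply]
    rw [e1]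
    exact pow_apply_mem_orbFin_of_fixed κ (by norm_num) hy333 _
  · -- Case B: κ' exchanges the column orbits; then PAF_b is the μ-twist of PAF_a — impossible
    exfalso
    rw [h3] at hrj₃
    have hB : ∀ tt : ZMod 333, b ((u : ZMod 333) * tt + ((j₃ : ZMod 333) + 332 * (c : ZMod 333))) = (d₁ x₀ * e₁ y₃) * a tt :=
      fun tt => haff y₃ y₄ j₃ hrj₃.symm tt
    exact legendrePair333_paf_twist_ne a b hL u (fun z _ => paf_of_affine a b u _ (hηpm y₃) hB z)

/-- **All or none.**  A signed automorphism normalising the permutation pair of an element of order `333` either maps every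
free row and every free column into its own `σ`-orbit (preserves all four cores), or maps every free row and every free column
out of its orbit (exchanges the two cores on both sides). -/
theorem hadamard668_order333_normalizing_all_or_none (hH : IsHadamardMatrix H) (hι : Fintype.card ι = 668)
    {π κ π' κ' : Equiv.Perm ι} {d e d' e' : ι → ℤ} (haut : IsSignedAut H π κ d e)
    (hπ : π ^ 333 = 1) (hκ : κ ^ 333 = 1) (h111 : π ^ 111 ≠ 1 ∨ κ ^ 111 ≠ 1) (h9 : π ^ 9 ≠ 1 ∨ κ ^ 9 ≠ 1)
    (haut' : IsSignedAut H π' κ' d' e') {μ : ℕ} (hnπ : π' * π = π ^ μ * π') (hnκ : κ' * κ = κ ^ μ * κ') :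
    ((∀ x, π x ≠ x → π' x ∈ orbFin π 333 x) ∧ (∀ y, κ y ≠ y → κ' y ∈ orbFin κ 333 y)) ∨
    ((∀ x, π x ≠ x → π' x ∉ orbFin π 333 x) ∧ (∀ y, κ y ≠ y → κ' y ∉ orbFin κ 333 y)) := by
  have hcard : (Fintype.card ι : ℤ) ≠ 0 := by rw [hι]; norm_num
  have hHt := isHadamard_transpose hH hcard
  -- columns preserved at one column ⇒ all rows preserved (the main lemma for Hᵀ)
  have colToRow : ∀ y, κ y ≠ y → κ' y ∈ orbFin κ 333 y → ∀ x, π x ≠ x → π' x ∈ orbFin π 333 x :=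
    fun y hy hmem => (normalizing_rows_preserved_main hHt hι (isSignedAut_transpose haut) hκ hπ h111.symm h9.symm
      (isSignedAut_transpose haut') hnκ hnπ hy hmem).1
  have rowToCol : ∀ x, π x ≠ x → π' x ∈ orbFin π 333 x → ∀ y, κ y ≠ y → κ' y ∈ orbFin κ 333 y :=
    fun x hx hmem => (normalizing_rows_preserved_main hH hι haut hπ hκ h111 h9 haut' hnπ hnκ hx hmem).1
  -- a moved row and a moved column exist
  obtain ⟨⟨hR2, -⟩, hC2, -⟩ := hadamard668_order333_orbitType hH hι π κ d e haut hπ hκ h111 h9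
  obtain ⟨x₁, hx₁⟩ : ∃ x, π x ≠ x := by
    by_contra hno
    push Not at hno
    have : (univ.filter fun i => π i = i) = univ := Finset.filter_true_of_mem fun i _ => hno i
    rw [this, Finset.card_univ, hι] at hR2
    norm_num at hR2
  obtain ⟨y₁, hy₁⟩ : ∃ y, κ y ≠ y := by
    by_contra hno
    push Not at hno
    have : (univ.filter fun j => κ j = j) = univ := Finset.filter_true_of_mem fun j _ => hno j
    rw [this, Finset.card_univ, hι] at hC2
    norm_num at hC2
  by_cases hrow : ∃ x, π x ≠ x ∧ π' x ∈ orbFin π 333 x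
  · obtain ⟨x, hx, hmem⟩ := hrow
    have hcols := rowToCol x hx hmem
    exact Or.inl ⟨colToRow y₁ hy₁ (hcols y₁ hy₁), hcols⟩
  · push Not at hrow
    refine Or.inr ⟨hrow, fun y hy hmem => ?_⟩
    exact hrow x₁ hx₁ (colToRow y hy hmem x₁ hx₁)

/-- **The dictionary: core-preserving normalising automorphisms are multipliers of a Legendre pair.**  If `τ` normalises the
permutation pair of `σ` (pair order `333`) with multiplier `μ` and maps some free row into its own `σ`-orbit, then there are a unit
`u ≡ μ (mod 333)` and a Legendre pair of length `333` both of whose sequences are invariant under the multiplier `u` in the narrow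
sense `x (u i) = x i` of RHdQ 2026 Definition 2. -/
theorem hadamard668_order333_normalizer_multiplier (hH : IsHadamardMatrix H) (hι : Fintype.card ι = 668)
    {π κ π' κ' : Equiv.Perm ι} {d e d' e' : ι → ℤ} (haut : IsSignedAut H π κ d e)
    (hπ : π ^ 333 = 1) (hκ : κ ^ 333 = 1) (h111 : π ^ 111 ≠ 1 ∨ κ ^ 111 ≠ 1) (h9 : π ^ 9 ≠ 1 ∨ κ ^ 9 ≠ 1)
    (haut' : IsSignedAut H π' κ' d' e') {μ : ℕ} (hnπ : π' * π = π ^ μ * π') (hnκ : κ' * κ = κ ^ μ * κ')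
    {x₀ : ι} (hx₀ : π x₀ ≠ x₀) (hmem : π' x₀ ∈ orbFin π 333 x₀) :
    ∃ (u : (ZMod 333)ˣ) (a b : ZMod 333 → ℤ), (u : ZMod 333) = (μ : ZMod 333) ∧ LegendrePair a b ∧
      HInvariant a u ∧ HInvariant b u := by
  obtain ⟨-, u, a, b, hu, hL, ha, hb⟩ := normalizing_rows_preserved_main hH hι haut hπ hκ h111 h9 haut' hnπ hnκ hx₀ hmem
  obtain ⟨a', b', hL', ha', hb'⟩ := (exists_twisted_iff ({u} : Set (ZMod 333)ˣ)).mp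
    ⟨a, b, hL, fun t ht => by rw [Set.mem_singleton_iff.mp ht]; exact ha, fun t ht => by rw [Set.mem_singleton_iff.mp ht]; exact hb⟩
  exact ⟨u, a', b', hu, hL', ha' u (Set.mem_singleton u), hb' u (Set.mem_singleton u)⟩

/-- **Corollary (RHdQ Proposition 1 in automorphism language): the multiplier of a core-preserving normalising automorphism is
`≡ 1 (mod 3)`** — in particular it is never `−1` on the cores (gen 19's inversion theorem is the case `μ = 332`). -/
theorem hadamard668_order333_normalizer_mod3 (hH : IsHadamardMatrix H) (hι : Fintype.card ι = 668)
    {π κ π' κ' : Equiv.Perm ι} {d e d' e' : ι → ℤ} (haut : IsSignedAut H π κ d e)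
    (hπ : π ^ 333 = 1) (hκ : κ ^ 333 = 1) (h111 : π ^ 111 ≠ 1 ∨ κ ^ 111 ≠ 1) (h9 : π ^ 9 ≠ 1 ∨ κ ^ 9 ≠ 1)
    (haut' : IsSignedAut H π' κ' d' e') {μ : ℕ} (hnπ : π' * π = π ^ μ * π') (hnκ : κ' * κ = κ ^ μ * κ')
    {x₀ : ι} (hx₀ : π x₀ ≠ x₀) (hmem : π' x₀ ∈ orbFin π 333 x₀) : μ % 3 = 1 := by
  obtain ⟨u, a, b, hu, hL, ha, hb⟩ := hadamard668_order333_normalizer_multiplier hH hι haut hπ hκ h111 h9 haut' hnπ hnκ hx₀ hmem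
  have hcop := coprime_of_normalizing hπ hκ h111 h9 hnπ hnκ
  have hval : (u : ZMod 333).val = μ % 333 := by rw [hu, ZMod.val_natCast]
  have h2 : (u : ZMod 333).val % 3 ≠ 2 := fun h2 => rhdq_prop1' a b hL u h2 ha hb
  have h3 : Nat.Coprime μ 3 := hcop.coprime_dvd_right (by norm_num)
  have h0 : μ % 3 ≠ 0 := by
    intro h0
    have h1 : 3 ∣ Nat.gcd μ 3 := Nat.dvd_gcd (Nat.dvd_of_mod_eq_zero h0) (dvd_refl 3)
    rw [Nat.Coprime.gcd_eq_one h3] at h1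
    omega
  rw [hval, Nat.mod_mod_of_dvd μ (by norm_num : 3 ∣ 333)] at h2
  omega

/-- **Corollary (the `112`-family): the multiplier of a core-preserving normalising automorphism is none of
`31, 43, 112, 142, 184, 223, 265, 295 (mod 333)`** — the units `≡ 1 (mod 3)` having a power equal to `112` or `223 = 112⁻¹`
(the eighth power always is one of them), excluded by the `n/3 + 1` multiplier obstruction `no_legendrePair_mul`. -/
theorem hadamard668_order333_normalizer_not_112_family (hH : IsHadamardMatrix H) (hι : Fintype.card ι = 668)
    {π κ π' κ' : Equiv.Perm ι} {d e d' e' : ι → ℤ} (haut : IsSignedAut H π κ d e)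
    (hπ : π ^ 333 = 1) (hκ : κ ^ 333 = 1) (h111 : π ^ 111 ≠ 1 ∨ κ ^ 111 ≠ 1) (h9 : π ^ 9 ≠ 1 ∨ κ ^ 9 ≠ 1)
    (haut' : IsSignedAut H π' κ' d' e') {μ : ℕ} (hnπ : π' * π = π ^ μ * π') (hnκ : κ' * κ = κ ^ μ * κ')
    {x₀ : ι} (hx₀ : π x₀ ≠ x₀) (hmem : π' x₀ ∈ orbFin π 333 x₀) :
    (μ : ZMod 333) ∉ ({31, 43, 112, 142, 184, 223, 265, 295} : Finset (ZMod 333)) := by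
  intro hμ
  obtain ⟨u, a, b, hu, hL, ha, -⟩ := hadamard668_order333_normalizer_multiplier hH hι haut hπ hκ h111 h9 haut' hnπ hnκ hx₀ hmem
  -- invariance under u⁸
  have hpow : ∀ k : ℕ, ∀ i, a ((u : ZMod 333) ^ k * i) = a i := by
    intro k; induction k with
    | zero => intro i; simp
    | succ k ih => intro i; rw [pow_succ, mul_assoc, ih, ha]
  have h8 : ∀ i, a ((μ : ZMod 333) ^ 8 * i) = a i := by rw [← hu]; exact hpow 8
  have key : (μ : ZMod 333) ^ 8 = ((111 : ℕ) : ZMod 333) + 1 ∨ (μ : ZMod 333) ^ 8 = 2 * ((111 : ℕ) : ZMod 333) + 1 := by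
    simp only [Finset.mem_insert, Finset.mem_singleton] at hμ
    rcases hμ with h | h | h | h | h | h | h | h <;> rw [h] <;> decide
  exact no_legendrePair_mul (n := 333) (m := 111) (by norm_num) (by norm_num) a b hL.1 hL.2.1 hL.2.2 _ key (Or.inl h8)

end main

end Summit.Ventures.DiscreteObjects.Hadamard
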